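import Summits.CriticalPhenomena.PercolationContinuityZ3.Theorems.Transplant.BoxProdZ2KitStepIV
import HarnessLib

/-!
# The target route `h3` for DEEP contacts of a tube level of `X □ ℤ²`: a fat quarter-face at planar scale `ℓ > M` is hit from the
# contact's inner prism inside the fat prism of scale `ℓ` (Kozma–Nitzan's "hittable quarter-face geometry", product version;
# BLUEPRINT-I-PHI §1 rows "Lemma 9", "target"; companion of `kitClause` / `kit_hIV`)

builds on p205010 (kernel theorem, internal audit signed; external expert review pending) — nothing in this file uses p205010.
Lane `prim-bschramm`, seat `prim-bschramm-p3` (Φ3-prod wiring, for the caller of `TargetProperty` on tube levels — Lemmas 11/12-prod);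
helper file (`--supports stmt-CriticalPhenomena-4575 --as helper`).

`kitClause` (p3) asks the caller, at every DEEP candidate contact `x` (frame `γ`, `γ c ∈ V₀`), for sets `Qt ⊆ D`, `Ft ⊆ T` off the cube and
the route `1 - δ² < P_W(linkIn Qt (Λˣ (msel τ)) Ft)`.  On `ℤ^d` this is KN's hittability of the quarter-face geometry (`isHittable_qfGeom`,
Lemma 9) at the scale `ℓ` of the target.  **`deep_h3`**: for `ℓ > M`, with `Qt := Λˣ_ℓ = frame(Λ^fat_ℓ(τ))` and `Ft :=` the fat orthant
face `frame(B_X(τ, ψ ℓ) × orthantFace a τ' ℓ)`: `Ft ⊆ Qt`, `Ft` is disjoint from the cube `kitCube x` (a coordinate of its planar part is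
`v ± ℓ`, outside `v + Λ_M`), and — if `Qt ⊆ D` with fibres in the window — the route has `P_W`-probability equal to the standard
`P_p(linkIn Λ^fat_ℓ(τ) Λ^fat_{msel τ}(τ) (B_X(τ, ψ ℓ) × piece g ℓ))`, hence `> 1 - δ²` by the link clause of `exists_scales` AT SCALE `ℓ`
(which holds for every `ℓ ≥ M₀`).  So the caller's geometric duty at a deep contact reduces to: `frame(Λ^fat_ℓ(τ)) ⊆ D` (fibre room
`ψ ℓ` around `c`, planar room `ℓ` around `v`) and `T ⊇` the fat orthant face.

[cite: KozmaNitzan2024, §4 p. 16 (hittable geometry, target), Lemma 9; pp. 20–21 ((23)–(25)) — the ℤ^d model]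
-/

noncomputable section

open MeasureTheory

namespace Summit.CriticalPhenomena.PercolationContinuityZ3.Theorems

namespace Transplant

namespace BoxProdZ2

open Literature.Probability.Percolation Literature.Probability.LatticeModels SimpleGraph KNLevels KozmaNitzan
open Literature.Probability.Percolation.GM

variable {W : Type} [DecidableEq W] (X : SimpleGraph W) [X.LocallyFinite]

/-- **The fat orthant face of scale `ℓ > M` is off the cube of scale `M`** (same frame): a planar coordinate of the face is `v_a ± ℓ`,
while the cube's planar part is `v + Λ_M`. [cite: KozmaNitzan2024, §4 p. 16 (ℓF far from v + Λ_M)] -/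
theorem disjoint_fatOrthantFace_kitCube (B : Finset W) (γ : X ≃g X) {M ℓ : ℕ} (hMℓ : M < ℓ) (a : Fin 2) (τ' : Fin 2 → ℤˣ)
    (xe : W) (Rw nF : ℕ) (Lo Hi : Site 2) (x : W × Site 2) :
    Disjoint ((B ×ˢ orthantFace a τ' ℓ).image (prodFrameIso X γ.symm
        (vctr Lo Hi M (pwin Lo Hi M x.2).1 (pwin Lo Hi M x.2).2.1 (pwin Lo Hi M x.2).2.2)))
      (kitCube X xe Rw Lo Hi M nF x) := by
  rw [Finset.disjoint_left]
  intro u hu hcube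
  rw [image_prodFrameIso_product, Finset.mem_product] at hu
  obtain ⟨t, ht, htu⟩ := Finset.mem_image.1 hu.2
  obtain ⟨-, hta, -⟩ := mem_orthantFace.1 ht
  rw [kitCube, Finset.mem_product, mem_cube_iff_sub_mem_box, mem_box] at hcube
  have h := hcube.2 a
  rw [← htu, add_sub_cancel_right] at h
  rcases Int.units_eq_one_or (τ' a) with h1 | h1 <;> rw [h1] at hta <;> push_cast at hta <;> omega

/-- The fat orthant face lies in the fat prism of the same scale (same frame). [folklore] -/
theorem fatOrthantFace_subset_frameSeq [Countable W] {p : unitInterval} (hT : TubeSubcritical X p) (V₀ : Finset W) (γ : X ≃g X)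
    (v : Site 2) (τ : W) (ℓ : ℕ) (a : Fin 2) (τ' : Fin 2 → ℤˣ) :
    (ballFin X τ (ufatRadius X hT V₀ ℓ) ×ˢ orthantFace a τ' ℓ).image (prodFrameIso X γ.symm v) ⊆ frameSeq X hT V₀ γ v τ ℓ :=
  Finset.image_subset_image (Finset.product_subset_product le_rfl fun _ ht => (mem_orthantFace.1 ht).1)

/-- **The deep-contact target route.**  For `ℓ > M`, the link clause of the standard estimates AT SCALE `ℓ`, a subbox weighting `Wt` of the
tube graph on `D`, a frame `γ` of the contact with `γ c ∈ V₀`, and `Λˣ_ℓ ⊆ D` with fibres in the window: the fat orthant face `Ft` of scale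
`ℓ` satisfies `Ft ⊆ Λˣ_ℓ`, `Ft ∩ kitCube x = ∅`, and `1 - δ² < P_{Wt}(linkIn Λˣ_ℓ (Λˣ (msel τ)) Ft)` — the `h3` input of `kit_hIV` /
`kitClause` with `Qt := Λˣ_ℓ`. [cite: KozmaNitzan2024, §4 p. 16 (hittable), Lemma 9, p. 21 ((24)–(25))] -/
theorem deep_h3 [Countable W] {p : unitInterval} (hT : TubeSubcritical X p) (V₀ : Finset W) {δ : ℝ} {msel : W → ℕ} {M ℓ : ℕ}
    (hMℓ : M < ℓ)
    (hlink : ∀ τ ∈ V₀, ∀ g : HOct 2, 1 - δ ^ 2 < (bondPercolation (X □ zdGraph 2) p).real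
      (linkIn (↑(ufatSeq X hT V₀ τ ℓ)) (ufatSeq X hT V₀ τ (msel τ)) (ballFin X τ (ufatRadius X hT V₀ ℓ) ×ˢ piece g ℓ)))
    {xe : W} {Rw : ℕ} {Lo Hi : Site 2} {Wt : Sym2 (W × Site 2) → unitInterval} {D : Finset (W × Site 2)}
    (hWD : IsSubbox (tubeGraph X (ballFin X xe Rw)) Wt p D) {x : W × Site 2} (γ : X ≃g X)
    (hγ : γ (fibCtrT X xe Rw (ufatRadius X hT V₀ M) x.1) ∈ V₀)
    (hQD : frameSeq X hT V₀ γ (vctr Lo Hi M (pwin Lo Hi M x.2).1 (pwin Lo Hi M x.2).2.1 (pwin Lo Hi M x.2).2.2)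
      (γ (fibCtrT X xe Rw (ufatRadius X hT V₀ M) x.1)) ℓ ⊆ D)
    (hQπ : ∀ u ∈ frameSeq X hT V₀ γ (vctr Lo Hi M (pwin Lo Hi M x.2).1 (pwin Lo Hi M x.2).2.1 (pwin Lo Hi M x.2).2.2)
      (γ (fibCtrT X xe Rw (ufatRadius X hT V₀ M) x.1)) ℓ, u.1 ∈ ballFin X xe Rw)
    (a : Fin 2) (τ' : Fin 2 → ℤˣ) :
    let v := vctr Lo Hi M (pwin Lo Hi M x.2).1 (pwin Lo Hi M x.2).2.1 (pwin Lo Hi M x.2).2.2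
    let τ := γ (fibCtrT X xe Rw (ufatRadius X hT V₀ M) x.1)
    let Ft := (ballFin X τ (ufatRadius X hT V₀ ℓ) ×ˢ orthantFace a τ' ℓ).image (prodFrameIso X γ.symm v)
    Ft ⊆ frameSeq X hT V₀ γ v τ ℓ ∧ Disjoint Ft (kitCube X xe Rw Lo Hi M (ufatRadius X hT V₀ M) x) ∧
      1 - δ ^ 2 < (prodBernoulli Wt).real (linkIn (↑(frameSeq X hT V₀ γ v τ ℓ)) (frameSeq X hT V₀ γ v τ (msel τ)) Ft) := by
  intro v τ Ft
  refine ⟨fatOrthantFace_subset_frameSeq X hT V₀ γ v τ ℓ a τ', disjoint_fatOrthantFace_kitCube X _ γ hMℓ a τ' xe Rw _ Lo Hi x, ?_⟩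
  rw [real_cubeEvent_eq X hWD hQD hQπ (determinedBy_linkIn _ _ _ le_rfl) (measurableSet_linkIn _ _ _)]
  have h := real_linkIn_image_iso (G := X □ zdGraph 2) (prodFrameIso X γ.symm v) p (ufatSeq X hT V₀ τ ℓ) (ufatSeq X hT V₀ τ (msel τ))
    (ballFin X τ (ufatRadius X hT V₀ ℓ) ×ˢ orthantFace a τ' ℓ)
  change 1 - δ ^ 2 < (bondPercolation (X □ zdGraph 2) p).real (linkIn (↑((ufatSeq X hT V₀ τ ℓ).image (prodFrameIso X γ.symm v)))
    ((ufatSeq X hT V₀ τ (msel τ)).image (prodFrameIso X γ.symm v))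
    ((ballFin X τ (ufatRadius X hT V₀ ℓ) ×ˢ orthantFace a τ' ℓ).image (prodFrameIso X γ.symm v)))
  rw [h, product_orthantFace_eq_piece]
  exact hlink τ hγ _

end BoxProdZ2

end Transplant

end Summit.CriticalPhenomena.PercolationContinuityZ3.Theorems

end
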